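import Summits.KontsevichZagierPeriods.KontsevichZagierPeriods.Theorems.HurwitzMicroSectorsNormalFormPrincipleM2FiveZetaTwo

/-!
# `NormalFormPrinciple` (stmt-KontsevichZagierPeriods-3869), line `SketchIdeator1` — leaf `stub_boxRigidity`:
# affine-unfoldable boxes: the general affine unfolding `[band-box, 1/(A(x)+xy)] ≡ M(1/x, (A(x)+x)/A(x))`

Registered sub-goal `affineUnfold_box_sub_logMonomial` of wave 5 (affine-unfoldable boxes) of the
layer `stub_boxRigidity` in dimension two (lead file `…M2`), the verbatim generalisation of
`boxQuad_sub_logMonomial` (edge `A(x) = 1 + x²`) to an arbitrary edge `A : ℝ → ℝ` that is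
`ℚ`-semialgebraic, differentiable and positive on `σ = {0 < x < 1} ⊆ ℝ¹`. For any representation
`T` on the band-box `{0 < x < 1, 0 ≤ y ≤ 1} = KZlog.band σ 0 1` with integrand `1/(A(x) + x y)`
there, and any representation `W` on the band `{0 < x < 1, 1 ≤ s ≤ (A(x) + x)/A(x)}` with
integrand `(1/x)/s` there (the unfolded log monomial `M(1/x, (A(x) + x)/A(x))`), the difference
`[T] − [W]` is a relation: it is ONE instance of Kontsevich–Zagier's rule (2), the affine
substitution `s = 1 + x y/A(x)` along the last coordinate over the open base `σ`
(`KZ.of_sub_of_mem_relations_of_affine` with `α = 1`, `β = x/A(x) > 0`, Jacobian `β`), since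
`(1/x)/(1 + x y/A(x)) · x/A(x) = 1/(A(x) + x y)` and the edges `0 ≤ y ≤ 1` go to
`1 ≤ s ≤ 1 + x/A(x) = (A(x) + x)/A(x)`.

References: M. Kontsevich, D. Zagier, *Periods* (2001), §1.2, rule (2). No new definitions.
-/

noncomputable section

open MeasureTheory Set
open Literature.NumberTheory.Transcendental Literature.NumberTheory.Transcendental.KZ
open Literature.ModelTheory.ExponentialFields (IsSemialgebraic)

namespace Summit.KontsevichZagierPeriods.HurwitzMicroSectors.NormalFormPrinciple.PiBox.M2

/-- The pointwise identity behind the affine unfolding `s = 1 + x y/a` (`a = A(x)`):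
`1/(a + x t) = (1/x)/(1 + (x/a) t) · x/a` for `a > 0`, `x > 0`, `t ≥ 0`. [folklore] -/
theorem affineUnfold_box_affine_identity {a x t : ℝ} (ha : 0 < a) (hx : 0 < x) (ht : 0 ≤ t) :
    1 / (a + x * t) = 1 / x / (1 + x / a * t) * (x / a) := by
  have h1 : a ≠ 0 := ha.ne'
  have h2 : a + x * t ≠ 0 := by positivity
  have h3 : 1 + x / a * t = (a + x * t) / a := by
    field_simp
  rw [h3]
  field_simp

/-- The upper edge of the unfolded band: `(a + x)/a = 1 + (x/a) · 1` for `a ≠ 0`. [folklore] -/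
theorem affineUnfold_box_upper_edge {a : ℝ} (ha : a ≠ 0) (x : ℝ) :
    (a + x) / a = 1 + x / a * 1 := by
  field_simp

/-- **The general affine unfolding** (Kontsevich–Zagier rule 2; registered sub-goal of wave 5,
affine-unfoldable boxes, of `stub_boxRigidity` in dimension two). Let `A : ℝ → ℝ` be
`ℚ`-semialgebraic, differentiable and positive on `σ = {0 < x < 1}`. For any representation `T`
on the band-box `{0 < x < 1, 0 ≤ y ≤ 1}` with integrand `1/(A(x) + x y)` there and any
representation `W` on the band `{0 < x < 1, 1 ≤ s ≤ (A(x) + x)/A(x)}` with integrand `(1/x)/s`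
there, `[T] − [W] ∈ relations`: the substitution `s = 1 + x y/A(x)` along the last coordinate
over the open base `(0,1)` (`KZ.of_sub_of_mem_relations_of_affine`, `α = 1`, `β = x/A(x)`,
Jacobian `β`) carries the band-box onto the band, and `(1/x)/(1 + x y/A(x)) · x/A(x) =
1/(A(x) + x y)`. [cite: KontsevichZagier2001, §1.2 rule (2)] -/
theorem affineUnfold_box_sub_logMonomial (A : ℝ → ℝ)
    (hA : IsSemialgebraicFunOn ℚ {y : Fin 1 → ℝ | 0 < y 0 ∧ y 0 < 1} (fun y => A (y 0)))
    (hAd : DifferentiableOn ℝ (fun y : Fin 1 → ℝ => A (y 0)) {y : Fin 1 → ℝ | 0 < y 0 ∧ y 0 < 1})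
    (hA0 : ∀ x ∈ Set.Ioo (0:ℝ) 1, 0 < A x) (T W : IntegralRep 2)
    (hTd : T.domain = KZlog.band {y : Fin 1 → ℝ | 0 < y 0 ∧ y 0 < 1} (fun _ => (0:ℝ)) (fun _ => (1:ℝ)))
    (hTi : EqOn T.integrand (fun z => 1 / (A (z 0) + z 0 * z 1)) T.domain)
    (hWd : W.domain = KZlog.band {y : Fin 1 → ℝ | 0 < y 0 ∧ y 0 < 1} (fun _ => (1:ℝ))
      (fun y => (A (y 0) + y 0) / A (y 0)))
    (hWi : EqOn W.integrand (fun z => (1 / z 0) / z 1) W.domain) :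
    of T - of W ∈ relations := by
  -- the open base `G = (0,1) ⊆ ℝ¹`
  have hG : IsSemialgebraic ℚ {y : Fin 1 → ℝ | 0 < y 0 ∧ y 0 < 1} :=
    isSemialgebraic_unitInterval_fin_one
  have hGo : IsOpen {y : Fin 1 → ℝ | 0 < y 0 ∧ y 0 < 1} :=
    isOpen_Ioo.preimage (continuous_apply 0)
  -- the edge does not vanish on the base
  have hA0' : ∀ y ∈ {y : Fin 1 → ℝ | 0 < y 0 ∧ y 0 < 1}, A (y 0) ≠ 0 :=
    fun y hy => (hA0 (y 0) hy).ne'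
  -- the coefficients `α = 1`, `β = x/A(x)` of the substitution
  have hα : IsSemialgebraicFunOn ℚ {y : Fin 1 → ℝ | 0 < y 0 ∧ y 0 < 1} (fun _ => (1:ℝ)) := by
    simpa using isSemialgebraicFunOn_ratCast hG 1
  have hβ : IsSemialgebraicFunOn ℚ {y : Fin 1 → ℝ | 0 < y 0 ∧ y 0 < 1}
      (fun y => y 0 / A (y 0)) :=
    (isSemialgebraicFunOn_apply hG 0).div hA hA0'
  have hβd : DifferentiableOn ℝ (fun y : Fin 1 → ℝ => y 0 / A (y 0))
      {y : Fin 1 → ℝ | 0 < y 0 ∧ y 0 < 1} := by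
    simpa only [div_eq_mul_inv] using
      (differentiableOn_apply (𝕜 := ℝ) (0 : Fin 1) _).fun_mul (hAd.fun_inv hA0')
  have hβpos : ∀ y ∈ {y : Fin 1 → ℝ | 0 < y 0 ∧ y 0 < 1}, 0 < y 0 / A (y 0) :=
    fun y hy => div_pos hy.1 (hA0 (y 0) hy)
  -- the integrands match along the substitution `s = 1 + (x/A(x)) y`
  have key : ∀ z ∈ T.domain, T.integrand z =
      W.integrand (Fin.snoc (Fin.init z)
        (1 + Fin.init z 0 / A (Fin.init z 0) * z (Fin.last 1))) *
        (Fin.init z 0 / A (Fin.init z 0)) := by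
    intro z hz
    have hz' := hz
    rw [hTd] at hz'
    obtain ⟨hzG, h0, h1⟩ := KZlog.mem_band.1 hz'
    have hx : 0 < Fin.init z 0 ∧ Fin.init z 0 < 1 := hzG
    have h0' : 0 ≤ z (Fin.last 1) := h0
    have h1' : z (Fin.last 1) ≤ 1 := h1
    have hAx : 0 < A (Fin.init z 0) := hA0 _ hzG
    have hb : 0 ≤ Fin.init z 0 / A (Fin.init z 0) := (hβpos _ hzG).le
    have hw : (Fin.snoc (Fin.init z) (1 + Fin.init z 0 / A (Fin.init z 0) * z (Fin.last 1)) :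
        Fin 2 → ℝ) ∈ W.domain := by
      rw [hWd]
      refine KZlog.mem_band.2 ?_
      rw [Fin.init_snoc, Fin.snoc_last]
      refine ⟨hzG, ?_, ?_⟩
      · show (1:ℝ) ≤ 1 + Fin.init z 0 / A (Fin.init z 0) * z (Fin.last 1)
        nlinarith [mul_nonneg hb h0']
      · show 1 + Fin.init z 0 / A (Fin.init z 0) * z (Fin.last 1) ≤
          (A (Fin.init z 0) + Fin.init z 0) / A (Fin.init z 0)
        rw [affineUnfold_box_upper_edge hAx.ne']
        nlinarith [mul_le_mul_of_nonneg_left h1' hb]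
    rw [hTi hz, hWi hw]
    show 1 / (A (z 0) + z 0 * z 1) =
      1 / z 0 / (1 + z 0 / A (z 0) * z 1) * (z 0 / A (z 0))
    exact affineUnfold_box_affine_identity hAx hx.1 h0'
  exact of_sub_of_mem_relations_of_affine (m := 1) hGo (α := fun _ => (1:ℝ))
    (β := fun y => y 0 / A (y 0)) (a := fun _ => (0:ℝ)) (b := fun _ => (1:ℝ))
    (a' := fun _ => (1:ℝ)) (b' := fun y => (A (y 0) + y 0) / A (y 0)) hα hβ
    (differentiableOn_const 1) hβd hβpos T W hTd hWd (fun y _ => by ring)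
    (fun y hy => affineUnfold_box_upper_edge (hA0' y hy) (y 0)) key

end Summit.KontsevichZagierPeriods.HurwitzMicroSectors.NormalFormPrinciple.PiBox.M2
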